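import Summits.BirchSwinnertonDyer.BirchSwinnertonDyer.Theorems.PrintCf2RubinValueTwoEllipticUnitsTwoVariableMeasure
import Summits.BirchSwinnertonDyer.BirchSwinnertonDyer.Theorems.PrintCf2RubinValueTwoEllipticUnitsTwoVariableDivisionTwists
import Summits.BirchSwinnertonDyer.BirchSwinnertonDyer.Theorems.PrintCf2RubinValueTwoEllipticUnitsLocalMeasureDischarged
import Literature.NumberTheory.GaloisRepresentations.LocalFieldInertiaCdOne
import HarnessLib

/-!
# de Shalit II.4.14 Step 1 ON `Γ_K` — EVERY non-print hypothesis DISCHARGED at a principal split prime `v ∣ 2` of an imaginary quadratic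
# field: the two-variable measure for the moduli `𝔣_m = 𝔤 v̄^{m+1}` EXISTS, modulo the four de Shalit II.2 prints only

Cell `bsd-print-cf2`, width seat `bsd-line-cf2-p1-w8` g10 (the (e)-assembly of the measure lane's chain B2 + (3): coherent local models);
`--supports` the banked S3a item stmt-BirchSwinnertonDyer-24721 (helper, Theses-free).  THEOREMS ONLY; CONDITIONAL on the FOUR published named
facts `DeShalit1987.prop24_i_mem_rayClassField`, `prop24_ii_galoisAction`, `prop24_iii_unit`, `prop25_i_normRelation` (hypotheses, never asserted).

`…EllipticUnitsTwoVariableMeasure.exists_twoVariable_groupDistribution_ellipticUnitsGlobal_of_principal` is de Shalit's II.4.14 Step 1 ON `Γ_K`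
for a chain of moduli `𝔣_{m+1} = 𝔣_m𝔩`, given — for every `m` — a local model at `v` (`α_m, f_m, E_m, j_m, ψ_m`) SHARING `π = u·2, ε, σ₀, θ, e₂`,
with `E_m ≤ E_{m+1}`, `j_{m+1} ∘ ι = j_m`, ARBITRARY Artin lifts, elliptic-unit families, and principal division twists at every modulus.  THIS
file runs the discharge chain for `𝔣_m = 𝔤v̄^{m+1}` (`K` imaginary quadratic, `2 = v v̄`, `v = (α₀)`, `𝔤 ≠ 0` `Aut(𝓞_K)`-stable with `w_𝔤 = 1`,
`v ∤ 𝔤`, `v̄ ∤ 𝔤`): `e₂ : 𝒪_v ≅ ℤ₂` (degree one), ONE `u = α₀/2` (`exists_unit_mul_two_eq`), `f_m` with `α₀^{f_m} ≡ 1 mod 𝔣_m`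
(`exists_pow_sub_one_mem_of_asIdeal_eq_span`), `E_m := unrStage K_v (Σ_{i≤m} f_i)` (INCREASING finite Galois unramified layers
containing `K_v(ζ_{2^{f_m}−1})`), `j_m := unitBallToUnrCoeff` (compatible with the inclusions), `σ₀, ε, θ` once, `ψ_m` per modulus, the
twist family := ALL ideals prime to `𝔤v̄v` with lifts serving ALL moduli (`exists_forall_absRestrictNormalHom_eq_artinHom`), elliptic units by
`exists_forall_isThetaValueOne'`, division twists `(1+x)^{2^m}`, `σ((1+x)^{2^m})` by `exists_divisionTwists_twoVariable`:

* §1 bookkeeping for the moduli `𝔤v̄^{m+1}`, `unrStage_le_maxUnramified`, `unitBallToUnrCoeff_inclUnitBall` (`j_{m+1} ∘ ι = j_m`),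
  `conj_mem_of_mem` (`σ(v) ⊆ v̄` from `σ(v̄) ⊆ v`);
* §2 ★★★ `exists_twoVariableMeasure_of_principal_split` — **∃ (all the per-modulus data), ∃ μ on `Γ_K` along the diagonal tower
  `V_n = Gal(K̄/K(𝔤v̄^{n+1}v^{n+1}))`, `‖μ‖ = 1`, `δ_{g_𝔠, N𝔠} μ = i_n(e_{𝔤v̄^{n+1}}(𝔠))` at every level `n`, for EVERY `𝔠 ≠ 0` prime to `𝔤v̄v`**
  — de Shalit's `μ_𝔞`-measures of II.4.14 Step 1 on `𝒢 = Gal(K(𝔤2^∞)/K)`, GIVEN only the four prints.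

HONEST FRAMING: plumbing / integration of accepted kernel theorems; the four prints stay hypotheses; the analytic heart (II.4.14 (36): Eisenstein
numbers = `L`-values) is NOT here; nothing here closes a crux; no summit statement is proved; BSD is not proved by any of this.

## References
* [deShalit1987] E. de Shalit, *Iwasawa theory of elliptic curves with complex multiplication* (1987), II.4.14 Step 1 (p. 71), II.4.12 (p. 66–69),
  II.4.17 (p. 77–78), I.3.8 (p. 20).
* [NeukirchANT1999] J. Neukirch, *Algebraic Number Theory* (1999), Ch. I §9 (9.1), Ch. VI §7 Thm. (7.1).
* [SerreLocalFields1979] J.-P. Serre, *Local Fields* (1979), Ch. IV §4.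
-/

-- the summit namespace `Summit.BirchSwinnertonDyer.BirchSwinnertonDyer` repeats the problem name by design (D-0017)
set_option linter.dupNamespace false
set_option autoImplicit false

noncomputable section

open scoped Classical nonZeroDivisors NumberField
open Field IsDedekindDomain IsDedekindDomain.HeightOneSpectrum ValuativeRel IsLocalRing MvPowerSeries
open Literature.NumberTheory.NumberFields
open Literature.NumberTheory.GaloisRepresentations Literature.NumberTheory.GaloisRepresentations.IsNonarchimedeanLocalField
  Literature.NumberTheory.GaloisRepresentations.LubinTate Literature.NumberTheory.GaloisRepresentations.ArtinLocalGlobal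
  Literature.NumberTheory.PAdicHodge
open Literature.NumberTheory.EllipticCurves Literature.NumberTheory.EllipticCurves.GroupDistribution
open Literature.NumberTheory.ComplexMultiplication.EllipticUnits
open Literature.NumberTheory.LFunctions.AbelianDensity (artinSymbol)
open Summit.BirchSwinnertonDyer.BirchSwinnertonDyer.Theorems.PrintCf2.EllipticUnitsLocal
open Summit.BirchSwinnertonDyer.BirchSwinnertonDyer.Theorems.PrintCf2.EllipticUnitsGlobal

namespace Summit.BirchSwinnertonDyer.BirchSwinnertonDyer.Theorems.PrintCf2.EllipticUnitsTwoVariable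

variable {K : Type} [Field K] [NumberField K] {𝔤 : Ideal (𝓞 K)} {v vbar : HeightOneSpectrum (𝓞 K)}

/-! ## §1. Bookkeeping: the moduli `𝔤v̄^{m+1}`, the unramified stages, the coefficient maps, conjugation -/

omit [NumberField K] in
/-- `𝔤v̄^{m+1} ≠ 0`. [cite: deShalit1987, II.4.14 Step 1 (p. 71)] -/
theorem modulus_ne_bot (h𝔤0 : 𝔤 ≠ ⊥) (m : ℕ) : 𝔤 * vbar.asIdeal ^ (m + 1) ≠ ⊥ := mul_pow_succ_ne_bot h𝔤0 vbar m

omit [NumberField K] in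
/-- `𝔤v̄^{m+2} = 𝔤v̄^{m+1}·v̄`. [cite: deShalit1987, II.4.14 Step 1 (p. 71)] -/
theorem modulus_succ (m : ℕ) : 𝔤 * vbar.asIdeal ^ (m + 1 + 1) = 𝔤 * vbar.asIdeal ^ (m + 1) * vbar.asIdeal := by
  rw [pow_succ, mul_assoc]

omit [NumberField K] in
/-- `𝔤v̄^{m+2} ≤ 𝔤v̄^{m+1}`. [cite: deShalit1987, II.4.14 Step 1 (p. 71)] -/
theorem modulus_anti (m : ℕ) : 𝔤 * vbar.asIdeal ^ (m + 1 + 1) ≤ 𝔤 * vbar.asIdeal ^ (m + 1) := by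
  rw [modulus_succ]; exact Ideal.mul_le_right

/-- `v ∤ 𝔤v̄^{m+1}` for `v ∤ 𝔤`, `v ≠ v̄`. [cite: deShalit1987, II.4.14 (p. 70)] -/
theorem not_modulus_le (hv : ¬ 𝔤 ≤ v.asIdeal) (hne : vbar ≠ v) (m : ℕ) : ¬ 𝔤 * vbar.asIdeal ^ (m + 1) ≤ v.asIdeal := by
  intro h
  rcases (v.isPrime.mul_le.mp h) with h1 | h1
  · exact hv h1
  · exact hne (HeightOneSpectrum.ext (vbar.isMaximal.eq_of_le v.isPrime.ne_top (v.isPrime.le_of_pow_le h1)).symm).symm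

omit [NumberField K] in
/-- `w_{𝔤v̄^{m+1}} = 1` from `w_𝔤 = 1`. [cite: deShalit1987, II.1.7 (p. 41)] -/
theorem units_eq_one_modulus (hw : ∀ u : (𝓞 K)ˣ, (u : 𝓞 K) - 1 ∈ 𝔤 → u = 1) (m : ℕ) (u : (𝓞 K)ˣ)
    (hu : (u : 𝓞 K) - 1 ∈ 𝔤 * vbar.asIdeal ^ (m + 1)) : u = 1 :=
  hw u (Ideal.mul_le_right hu)

omit [NumberField K] in
/-- A twist prime to `𝔤v̄v` is prime to every `𝔤v̄^{m+1}v`. [folklore] -/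
theorem isCoprime_modulus_mul {𝔠 : Ideal (𝓞 K)} (h : IsCoprime 𝔠 (𝔤 * vbar.asIdeal * v.asIdeal)) (m : ℕ) :
    IsCoprime 𝔠 (𝔤 * vbar.asIdeal ^ (m + 1) * v.asIdeal) :=
  (h.of_mul_right_left.of_mul_right_left.mul_right h.of_mul_right_left.of_mul_right_right.pow_right).mul_right h.of_mul_right_right

/-- **The unramified stages lie in `F^nr`** (each `F_n = F(ζ_{q^n−1})` does). [cite: SerreLocalFields1979, Ch. IV §4] -/
theorem unrStage_le_maxUnramified (F : Type) [Field F] [ValuativeRel F] [TopologicalSpace F] [IsNonarchimedeanLocalField F] :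
    ∀ k : ℕ, unrStage F k ≤ maxUnramified F
  | 0 => unramifiedLevel_le_maxUnramified F Nat.one_pos
  | k + 1 => sup_le (unrStage_le_maxUnramified F k) (unramifiedLevel_le_maxUnramified F (Nat.succ_pos (k + 1)))

section Coeff

variable {F : Type} [Field F] [ValuativeRel F] [TopologicalSpace F] [IsNonarchimedeanLocalField F]
  {E E' : IntermediateField F (AlgebraicClosure F)} [FiniteDimensional F E] [FiniteDimensional F E']

attribute [local instance] ltNormUniformSpace ltNormIsUniformAddGroup rk1 nF nE fintypeResidueField

/-- ★ **`j_{E′} ∘ ι = j_E`**: the coefficient maps `unitBallToUnrCoeff` of two unramified coefficient fields `E ≤ E′` are compatible with the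
inclusion of valuation rings (both read `x ∈ 𝒪_E ⊆ 𝒪_{F^nr}` in `𝒪̂_{F^nr}`). [cite: deShalit1987, I.3.8 (p. 20)] -/
theorem unitBallToUnrCoeff_inclUnitBall (hE : E ≤ maxUnramified F) (hE' : E' ≤ maxUnramified F) (h : E ≤ E') (y : unitBall E) :
    unitBallToUnrCoeff hE' (inclUnitBall (F := F) h y) = unitBallToUnrCoeff hE y := by
  have h1 : unitBallToMaxUnramifiedIntegers hE' (inclUnitBall (F := F) h y) = unitBallToMaxUnramifiedIntegers hE y :=
    Subtype.ext (by rw [coe_unitBallToMaxUnramifiedIntegers, coe_unitBallToMaxUnramifiedIntegers]; rfl)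
  rw [unitBallToUnrCoeff_apply, unitBallToUnrCoeff_apply, h1]

end Coeff

/-- **`σ(v) ⊆ v̄` from `σ(v̄) ⊆ v`** for an involution `σ` of `𝓞_K` (`σ(v̄)` is a maximal ideal inside `v`, so equal to it).
[cite: NeukirchANT1999, Ch. I §9 (9.1)] -/
theorem conj_mem_of_mem (σ : 𝓞 K ≃+* 𝓞 K) (hσσ : ∀ a, σ (σ a) = a) (hσv' : ∀ y ∈ vbar.asIdeal, σ y ∈ v.asIdeal)
    (y : 𝓞 K) (hy : y ∈ v.asIdeal) : σ y ∈ vbar.asIdeal := by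
  have h1 : Ideal.map σ vbar.asIdeal ≤ v.asIdeal := Ideal.map_le_iff_le_comap.mpr fun z hz ↦ hσv' z hz
  haveI := vbar.isMaximal
  haveI : (Ideal.map σ vbar.asIdeal).IsMaximal := Ideal.map_isMaximal_of_equiv σ
  have h2 : Ideal.map σ vbar.asIdeal = v.asIdeal := Ideal.IsMaximal.eq_of_le inferInstance v.isPrime.ne_top h1
  rw [← h2] at hy
  obtain ⟨z, hz, hzy⟩ := (Ideal.mem_map_iff_of_surjective (σ : 𝓞 K →+* 𝓞 K) σ.surjective).mp hy
  have : σ y = z := by rw [← hzy]; exact hσσ z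
  rw [this]; exact hz

/-! ## §2. The discharge -/

section Discharged

attribute [local instance] GlobalNormCoherentUnits.instCommMonoid GlobalNormCoherentUnits.galAction
attribute [local instance] ltNormUniformSpace ltNormIsUniformAddGroup rk1 nF nE fintypeResidueField
attribute [local instance] RelNormCoherentUnits.instCommMonoid

set_option maxHeartbeats 3200000 in
/-- ★★★ **de Shalit II.4.14 Step 1 ON `Γ_K`, EVERY NON-PRINT HYPOTHESIS DISCHARGED.**  For `K` imaginary quadratic (`ι : K → ℂ`), a rational
prime `2 = v·v̄` SPLIT in `K` (`v̄ ≠ v`) with `v = (α₀)` principal, a modulus `𝔤 ≠ 0` stable under every automorphism of `𝓞_K` with `w_𝔤 = 1`,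
`v ∤ 𝔤`, `v̄ ∤ 𝔤`, and GIVEN the four prints de Shalit II.2.4 (i)/(ii)/(iii), II.2.5 (i): **there exist** per-modulus local data for the moduli
`𝔣_m = 𝔤v̄^{m+1}` — `hq, h2`, ONE `u` (`π = u·2`), exponents `f_m` with global witnesses `α_m = α₀^{f_m} ≡ 1 mod 𝔣_m`, INCREASING unramified Galois
coefficient fields `E_m` with `hdegE`, `σ₀, ε, θ` (continuous, norm `≤ 1` on the ball, onto the `2`-power roots of unity), compatible readings
`j_m` (`j_{m+1} ∘ ι = j_m`), `e₂ : 𝒪_v ≃ ℤ₂` with `hΘe`, cell maps `ψ_m` — and, for EVERY ideal `𝔠 ≠ 0` prime to `𝔤v̄v`, a lift `g_𝔠 ∈ Γ_K` of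
its Artin symbols on ALL `K(𝔣_m v^{k+1})` and elliptic units `x^𝔠_{m,k} ∈ K(𝔣_m v^{k+1})` under `Θ(1; 𝔣_m v^{k+1}, 𝔠)`, **and a bounded distribution
`μ` on `Γ_K` along the diagonal tower `V_n = Gal(K̄/K(𝔤v̄^{n+1}v^{n+1}))`, `‖μ‖ = 1`, with `δ_{g_𝔠, N𝔠} μ = i_n(e_{𝔣_n}(𝔠))` at level `n` for every
`𝔠` and every `n`** (`i_n = induceFrom (localMeasureFamily ∘ ofGlobalUnits)` at the modulus `𝔣_n`) — de Shalit's measures `μ_𝔠` on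
`𝒢 = Gal(K(𝔤2^∞)/K)` ("their inverse limit is a measure `μ_𝔞` on `𝒢`").
[cite: deShalit1987, II.4.14 Step 1 (p. 71), II.4.12 (p. 66–69), II.4.17 (p. 77–78)] [cite: NeukirchANT1999, Ch. VI §7 Thm. (7.1)] -/
theorem exists_twoVariableMeasure_of_principal_split [NumberField.IsTotallyComplex K]
    (h24i : DeShalit1987.prop24_i_mem_rayClassField) (h24ii : DeShalit1987.prop24_ii_galoisAction)
    (h24iii : DeShalit1987.prop24_iii_unit) (h25 : DeShalit1987.prop25_i_normRelation)
    (hK : IsImaginaryQuadratic K) (ι : K →+* ℂ)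
    (h𝔤0 : 𝔤 ≠ ⊥) (hw : ∀ u : (𝓞 K)ˣ, (u : 𝓞 K) - 1 ∈ 𝔤 → u = 1)
    (h𝔤σ : ∀ (σ : 𝓞 K ≃+* 𝓞 K) (y : 𝓞 K), y ∈ 𝔤 → σ y ∈ 𝔤)
    (hv2 : ((2 : ℕ) : 𝓞 K) ∈ v.asIdeal) (hvbar2 : ((2 : ℕ) : 𝓞 K) ∈ vbar.asIdeal) (hne : vbar ≠ v)
    (hv : ¬ 𝔤 ≤ v.asIdeal) (hvbar : ¬ 𝔤 ≤ vbar.asIdeal) {α₀ : 𝓞 K} (hv0 : v.asIdeal = Ideal.span {α₀}) :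
    ∃ (h𝔣0 : ∀ m : ℕ, 𝔤 * vbar.asIdeal ^ (m + 1) ≠ ⊥) (h𝔣1 : ∀ m : ℕ, 𝔤 * vbar.asIdeal ^ (m + 1) ≠ ⊤)
      (hvm : ∀ m : ℕ, ¬ 𝔤 * vbar.asIdeal ^ (m + 1) ≤ v.asIdeal)
      (hwm : ∀ (m : ℕ) (u : (𝓞 K)ˣ), (u : 𝓞 K) - 1 ∈ 𝔤 * vbar.asIdeal ^ (m + 1) → u = 1)
      (hle : ∀ m : ℕ, 𝔤 * vbar.asIdeal ^ (m + 1 + 1) ≤ 𝔤 * vbar.asIdeal ^ (m + 1))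
      (hq : residueFieldCard (v.adicCompletion K) = 2)
      (h2 : (valuation (v.adicCompletion K)).IsUniformizer ((((2 : ℕ) : 𝒪[v.adicCompletion K]) : v.adicCompletion K)))
      (u : 𝒪[v.adicCompletion K]ˣ)
      (α : ℕ → 𝓞 K) (hα0 : ∀ m, α m ≠ 0) (hα𝔣 : ∀ m, α m - 1 ∈ 𝔤 * vbar.asIdeal ^ (m + 1))
      (hαw : ∀ (m : ℕ) (w : HeightOneSpectrum (𝓞 K)), w ≠ v → α m ∉ w.asIdeal)
      (f : ℕ → ℕ) (hαπ : ∀ m, ((α m : K) : v.adicCompletion K) =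
        ((((u : 𝒪[v.adicCompletion K]) * ((2 : ℕ) : 𝒪[v.adicCompletion K]) : 𝒪[v.adicCompletion K]) : v.adicCompletion K)) ^ f m)
      (E : ℕ → IntermediateField (v.adicCompletion K) (AlgebraicClosure (v.adicCompletion K)))
      (_ : ∀ m, FiniteDimensional (v.adicCompletion K) (E m)) (_ : ∀ m, IsGalois (v.adicCompletion K) (E m))
      (hE : ∀ m, E m ≤ maxUnramified (v.adicCompletion K))
      (hdegE : ∀ (m : ℕ) (w : WeilGroup (v.adicCompletion K)),
        WeilGroup.toAbsGalois (v.adicCompletion K) w ∈ (E m).fixingSubgroup → (f m : ℤ) ∣ WeilGroup.deg w)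
      (hEE : ∀ m, E m ≤ E (m + 1))
      (σ₀ : absoluteGaloisGroup (v.adicCompletion K)) (hσ₀ : IsAbsArithFrob σ₀)
      (ε : (maxUnramifiedCompletion (v.adicCompletion K))ˣ)
      (hε : maxUnramifiedCompletion.galAut (v.adicCompletion K) σ₀ (ε : maxUnramifiedCompletion (v.adicCompletion K)) =
        algebraMap 𝒪[v.adicCompletion K] (maxUnramifiedCompletion (v.adicCompletion K)) (u : 𝒪[v.adicCompletion K]) *
          (ε : maxUnramifiedCompletion (v.adicCompletion K)))
      (θ : CompletedAlgClosure (v.adicCompletion K) →+* ℂ_[2]) (_ : Continuous θ)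
      (hθ1 : ∀ z : CBall (v.adicCompletion K), ‖θ (z : CompletedAlgClosure (v.adicCompletion K))‖ ≤ 1)
      (_ : ∀ ζ' : ℂ_[2], (∃ n : ℕ, ζ' ^ 2 ^ n = 1) →
        ∃ ζ : CompletedAlgClosure (v.adicCompletion K), (∃ n : ℕ, ζ ^ 2 ^ n = 1) ∧ θ ζ = ζ')
      (j : ∀ m : ℕ, unitBall (E m) →+* UnrCoeff (v.adicCompletion K))
      (_ : ∀ m, (j m).comp (algebraMap (LTCoeff (v.adicCompletion K)) (unitBall (E m))) =
        (intToUnrCoeff (v.adicCompletion K)).comp (LTCoeff.of (v.adicCompletion K)).symm.toRingHom)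
      (hjC : ∀ m, (algebraMap (UnrCoeff (v.adicCompletion K)) (CBall (v.adicCompletion K))).comp (j m) = unitBallToCBall (E m))
      (_ : ∀ (m : ℕ) (y : unitBall (E m)), j (m + 1) (inclUnitBall (F := v.adicCompletion K) (hEE m) y) = j m y)
      (e₂ : v.adicCompletionIntegers K ≃+* ℤ_[2])
      (_ : ∀ a : 𝒪[v.adicCompletion K], (θ.comp ((CBall (v.adicCompletion K)).subtype.comp
          (algebraMap (UnrCoeff (v.adicCompletion K)) (CBall (v.adicCompletion K))))) (intToUnrCoeff (v.adicCompletion K) a) =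
        padicIntCast ℂ_[2] (((e₂ : v.adicCompletionIntegers K →+* ℤ_[2]).comp
          (integerEquivAdicCompletionIntegers v).toRingHom) a))
      (ψ : ∀ m n : ℕ, ↥(absRestrictNormalHom (rayClassField K (𝔤 * vbar.asIdeal ^ (m + 1)))).ker ⧸
        (rayAdicTower (𝔪 := 𝔤 * vbar.asIdeal ^ (m + 1)) (h𝔣0 m) v).U n → ZMod (2 ^ (n + 1)))
      (hψ : ∀ (m n : ℕ) (g : ↥(absRestrictNormalHom (rayClassField K (𝔤 * vbar.asIdeal ^ (m + 1)))).ker),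
        g ∈ (rayAdicTower (𝔪 := 𝔤 * vbar.asIdeal ^ (m + 1)) (h𝔣0 m) v).U 0 →
        ψ m n ((rayAdicTower (𝔪 := 𝔤 * vbar.asIdeal ^ (m + 1)) (h𝔣0 m) v).proj n g) =
          PadicInt.toZModPow (n + 1) ((((Units.map (e₂ : v.adicCompletionIntegers K →+* ℤ_[2]).toMonoidHom).comp
            (rayAdicCharacter (h𝔣0 m) (hvm m) (hwm m)))⁻¹ g : ℤ_[2]ˣ) : ℤ_[2]))
      (g : {c : Ideal (𝓞 K) // c ≠ ⊥ ∧ IsCoprime c (𝔤 * vbar.asIdeal * v.asIdeal)} → absoluteGaloisGroup K)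
      (_ : ∀ (c : {c : Ideal (𝓞 K) // c ≠ ⊥ ∧ IsCoprime c (𝔤 * vbar.asIdeal * v.asIdeal)}) (m k : ℕ),
        absRestrictNormalHom (rayClassField K (𝔤 * vbar.asIdeal ^ (m + 1) * v.asIdeal ^ (k + 1))) (g c) =
          artinSymbol (galFrob K (rayClassField K (𝔤 * vbar.asIdeal ^ (m + 1) * v.asIdeal ^ (k + 1)))) c.1)
      (x : ∀ (_ : {c : Ideal (𝓞 K) // c ≠ ⊥ ∧ IsCoprime c (𝔤 * vbar.asIdeal * v.asIdeal)}) (m k : ℕ),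
        rayClassField K (𝔤 * vbar.asIdeal ^ (m + 1) * v.asIdeal ^ (k + 1)))
      (hx : ∀ (c : {c : Ideal (𝓞 K) // c ≠ ⊥ ∧ IsCoprime c (𝔤 * vbar.asIdeal * v.asIdeal)}) (m k : ℕ),
        IsThetaValueOne ι (𝔤 * vbar.asIdeal ^ (m + 1) * v.asIdeal ^ (k + 1)) c.1
          (algClosureEmb ι ((x c m k : rayClassField K (𝔤 * vbar.asIdeal ^ (m + 1) * v.asIdeal ^ (k + 1))) : AlgebraicClosure K)))
      (_ : ∀ m n, ((rayAdicTower (𝔪 := 𝔤 * vbar.asIdeal ^ (m + 1)) (h𝔣0 m) v).U n).Normal)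
      (_ : ∀ m n, ((absRayAdicTower (𝔪' := 𝔤 * vbar.asIdeal ^ (m + 1)) (h𝔣0 m) v).U n).Normal),
    ∃ μ : GroupDistribution (SubgroupTower.diagonal (fun m ↦ absRayAdicTower (𝔪' := 𝔤 * vbar.asIdeal ^ (m + 1)) (h𝔣0 m) v)
        (fun m n ↦ absRayAdicTower_U_anti (h𝔣0 m) (h𝔣0 (m + 1)) v (hle m) n)) ℂ_[2], μ.bound = 1 ∧
      ∀ (c : {c : Ideal (𝓞 K) // c ≠ ⊥ ∧ IsCoprime c (𝔤 * vbar.asIdeal * v.asIdeal)}) (n : ℕ)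
        (b : absoluteGaloisGroup K ⧸ (absRayAdicTower (𝔪' := 𝔤 * vbar.asIdeal ^ (n + 1)) (h𝔣0 n) v).U n),
        (twisting (g c) (Ideal.absNorm c.1 : ℂ_[2]) μ).μ n b =
        (GroupDistribution.induceFrom (Γ := absoluteGaloisGroup K)
          (fun k ↦ rayAdicTower_U_eq_subgroupOf (𝔪 := 𝔤 * vbar.asIdeal ^ (n + 1)) (h𝔣0 n) v k)
          (fun b : GlobalNormCoherentUnits (h𝔣0 n) v ↦
            localMeasureFamily (h𝔣0 n) (hvm n) (hwm n) hq h2 u (E n) (hE n) hσ₀ hε θ hθ1 (j n) (hjC n) e₂ (ψ n) (hψ n)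
              (RelNormCoherentUnits.ofGlobalUnits (h𝔣0 n) (hvm n) (hwm n) (isUniformizer_unit_mul h2 u) (hα0 n) (hα𝔣 n) (hαw n)
                (hαπ n) (E n) (hE n) (hdegE n) b))
          zero_le_one (fun _ ↦ le_rfl)
          (ellipticUnitsGlobal h24iii h25 hK ι (h𝔣0 n) (h𝔣1 n) (hvm n) (hwm n) c.2.1 (isCoprime_modulus_mul c.2.2 n) (x c n)
            (hx c n))).μ n b := by
  -- (0) the frame: `[K : ℚ] = 2`, `e(v|2) = f(v|2) = 1`; the moduli
  have hK2 : Module.finrank ℚ K = 2 := hK.1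
  haveI := liesOver_ratPlace_of_natCast_mem K v (p := 2) hv2
  obtain ⟨he, hf⟩ := ramificationIdx_eq_one_and_inertiaDeg_eq_one_of_natCast_mem_of_ne K hK2 (p := 2) hv2 hvbar2 hne
  have h𝔣0 : ∀ m : ℕ, 𝔤 * vbar.asIdeal ^ (m + 1) ≠ ⊥ := modulus_ne_bot h𝔤0
  have h𝔣1 : ∀ m : ℕ, 𝔤 * vbar.asIdeal ^ (m + 1) ≠ ⊤ := fun m ↦ mul_pow_succ_ne_top 𝔤 vbar m
  have hvm : ∀ m : ℕ, ¬ 𝔤 * vbar.asIdeal ^ (m + 1) ≤ v.asIdeal := not_modulus_le hv hne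
  have hwm : ∀ (m : ℕ) (u : (𝓞 K)ˣ), (u : 𝓞 K) - 1 ∈ 𝔤 * vbar.asIdeal ^ (m + 1) → u = 1 := units_eq_one_modulus hw
  -- (1) `e₂ : 𝒪_v ≃ ℤ₂`, `hq`, `h2`
  set e₂ : v.adicCompletionIntegers K ≃+* ℤ_[2] := padicIntEquivOfDegreeOne K 2 v he hf with he₂
  have hq : residueFieldCard (v.adicCompletion K) = 2 := residueFieldCard_adicCompletion_of_padicIntEquiv (v := v) e₂
  have h2 : (valuation (v.adicCompletion K)).IsUniformizer ((((2 : ℕ) : 𝒪[v.adicCompletion K]) : v.adicCompletion K)) :=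
    isUniformizer_natCast_adicCompletion_of_padicIntEquiv (v := v) e₂
  -- (2) ONE `u = α₀ / 2` and the exponents `f_m` with `α₀^{f_m} ≡ 1 mod 𝔣_m`
  obtain ⟨u, hu⟩ := exists_unit_mul_two_eq e₂ hv0
  have hF : ∀ m : ℕ, ∃ fm : ℕ, 0 < fm ∧ α₀ ^ fm - 1 ∈ 𝔤 * vbar.asIdeal ^ (m + 1) :=
    fun m ↦ exists_pow_sub_one_mem_of_asIdeal_eq_span (h𝔣0 m) (hvm m) hv0
  choose f hf0 hf𝔪 using hF
  have hαπ : ∀ m, (((α₀ ^ f m : 𝓞 K) : K) : v.adicCompletion K) =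
      ((((u : 𝒪[v.adicCompletion K]) * ((2 : ℕ) : 𝒪[v.adicCompletion K]) : 𝒪[v.adicCompletion K]) : v.adicCompletion K)) ^ f m := by
    intro m
    have h1 : ((α₀ ^ f m : 𝓞 K) : K) = ((α₀ : 𝓞 K) : K) ^ f m := by
      rw [NumberField.RingOfIntegers.coe_eq_algebraMap, map_pow, ← NumberField.RingOfIntegers.coe_eq_algebraMap]
    rw [h1, coe_pow_adicCompletion, hu]
  -- (3) the unramified stages `E_m := unrStage K_v (Σ_{i≤m} f_i)` (increasing)
  set Fsum : ℕ → ℕ := fun m ↦ (Finset.range (m + 1)).sum f with hFsum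
  have hFmono : ∀ m, Fsum m ≤ Fsum (m + 1) := fun m ↦ by
    simp only [hFsum, Finset.sum_range_succ _ (m + 1)]; exact Nat.le_add_right _ _
  have hfF : ∀ m, f m ≤ Fsum m + 1 := fun m ↦ by
    have : f m ≤ Fsum m := Finset.single_le_sum (f := f) (fun i _ ↦ Nat.zero_le _) (Finset.self_mem_range_succ m)
    omega
  set E : ℕ → IntermediateField (v.adicCompletion K) (AlgebraicClosure (v.adicCompletion K)) :=
    fun m ↦ unrStage (v.adicCompletion K) (Fsum m) with hEdef
  haveI hfd : ∀ m, FiniteDimensional (v.adicCompletion K) (E m) := fun m ↦ finiteDimensional_unrStage _ _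
  haveI hgal : ∀ m, IsGalois (v.adicCompletion K) (E m) := fun m ↦ isGalois_unrStage _ _
  have hE : ∀ m, E m ≤ maxUnramified (v.adicCompletion K) := fun m ↦ unrStage_le_maxUnramified _ _
  have hEE : ∀ m, E m ≤ E (m + 1) := fun m ↦ unrStage_mono _ (hFmono m)
  have hdegE : ∀ (m : ℕ) (w : WeilGroup (v.adicCompletion K)), WeilGroup.toAbsGalois (v.adicCompletion K) w ∈ (E m).fixingSubgroup →
      (f m : ℤ) ∣ WeilGroup.deg w := fun m w hw' ↦
    dvd_deg_of_toAbsGalois_mem_fixingSubgroup_unramifiedLevel _ (hf0 m) w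
      (IntermediateField.fixingSubgroup_antitone (unramifiedLevel_le_unrStage _ (hf0 m) (hfF m)) hw')
  -- (4) the common local analytic data: `σ₀`, `ε`, `θ`; the readings `j_m`
  obtain ⟨σ₀, hσ₀⟩ := exists_isAbsArithFrob_holds (v.adicCompletion K)
  obtain ⟨ε, hε⟩ := exists_unit_galAut_eq_mul hσ₀ u
  obtain ⟨θ, hθc, -, hθ1, hθζ, hΘe, -, -⟩ := Seam.exists_theta_two_moments_padicEquivOfDegreeOne K v he hf
  have hjj : ∀ (m : ℕ) (y : unitBall (E m)),
      unitBallToUnrCoeff (hE (m + 1)) (inclUnitBall (F := v.adicCompletion K) (hEE m) y) = unitBallToUnrCoeff (hE m) y :=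
    fun m y ↦ unitBallToUnrCoeff_inclUnitBall (hE m) (hE (m + 1)) (hEE m) y
  -- (5) the cell maps of `κ_v⁻¹`, per modulus
  have hΨ : ∀ m : ℕ, ∃ ψ : (n : ℕ) → ↥(absRestrictNormalHom (rayClassField K (𝔤 * vbar.asIdeal ^ (m + 1)))).ker ⧸
      (rayAdicTower (𝔪 := 𝔤 * vbar.asIdeal ^ (m + 1)) (h𝔣0 m) v).U n → ZMod (2 ^ (n + 1)),
      ∀ (n : ℕ) (g : ↥(absRestrictNormalHom (rayClassField K (𝔤 * vbar.asIdeal ^ (m + 1)))).ker),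
        g ∈ (rayAdicTower (𝔪 := 𝔤 * vbar.asIdeal ^ (m + 1)) (h𝔣0 m) v).U 0 →
        ψ n ((rayAdicTower (𝔪 := 𝔤 * vbar.asIdeal ^ (m + 1)) (h𝔣0 m) v).proj n g) =
          PadicInt.toZModPow (n + 1) ((((Units.map (e₂ : v.adicCompletionIntegers K →+* ℤ_[2]).toMonoidHom).comp
            (rayAdicCharacter (h𝔣0 m) (hvm m) (hwm m)))⁻¹ g : ℤ_[2]ˣ) : ℤ_[2]) := fun m ↦
    SubgroupTower.exists_cellMap_of_character (rayAdicTower (𝔪 := 𝔤 * vbar.asIdeal ^ (m + 1)) (h𝔣0 m) v)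
      ((Units.map (e₂ : v.adicCompletionIntegers K →+* ℤ_[2]).toMonoidHom).comp (rayAdicCharacter (h𝔣0 m) (hvm m) (hwm m)))⁻¹
      (mem_rayAdicTower_iff_inv (h𝔣0 m) (h𝔣0 m) (hvm m) (hwm m) e₂ le_rfl (hvm m))
  choose ψ hψ using hΨ
  -- (6) the twist family: ALL ideals prime to `𝔤v̄v`; lifts of their Artin symbols serving ALL moduli; their elliptic units
  have hG : ∀ c : {c : Ideal (𝓞 K) // c ≠ ⊥ ∧ IsCoprime c (𝔤 * vbar.asIdeal * v.asIdeal)}, ∃ σ : absoluteGaloisGroup K,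
      ∀ m k : ℕ, absRestrictNormalHom (rayClassField K (𝔤 * vbar.asIdeal ^ (m + 1) * v.asIdeal ^ (k + 1))) σ =
        artinSymbol (galFrob K (rayClassField K (𝔤 * vbar.asIdeal ^ (m + 1) * v.asIdeal ^ (k + 1)))) c.1 := by
    intro c
    obtain ⟨σ, hσ⟩ := exists_forall_absRestrictNormalHom_eq_artinHom (K := K)
      (Units.mk0 (c.1 : FractionalIdeal (𝓞 K)⁰ K) (coeIdeal_ne_zero_of_ne_bot c.2.1))
    refine ⟨σ, fun m k ↦ ?_⟩
    rw [hσ _ (mul_pow_succ_ne_bot (h𝔣0 m) v k)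
      (unitsMk0_coeIdeal_mem_idealsPrimeTo (mul_pow_succ_ne_bot (h𝔣0 m) v k) c.2.1
        (isCoprime_mul_pow_succ (isCoprime_modulus_mul c.2.2 m) k)),
      artinHom_unitsMk0_coeIdeal _ c.2.1]
  choose g hg using hG
  have hX : ∀ (c : {c : Ideal (𝓞 K) // c ≠ ⊥ ∧ IsCoprime c (𝔤 * vbar.asIdeal * v.asIdeal)}) (m : ℕ),
      ∃ x : ∀ k : ℕ, rayClassField K (𝔤 * vbar.asIdeal ^ (m + 1) * v.asIdeal ^ (k + 1)),
        ∀ k, IsThetaValueOne ι (𝔤 * vbar.asIdeal ^ (m + 1) * v.asIdeal ^ (k + 1)) c.1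
          (algClosureEmb ι ((x k : rayClassField K (𝔤 * vbar.asIdeal ^ (m + 1) * v.asIdeal ^ (k + 1))) : AlgebraicClosure K)) :=
    fun c m ↦ exists_forall_isThetaValueOne' h24i hK ι (h𝔣0 m) v c.2.1 (isCoprime_modulus_mul c.2.2 m)
  choose x hx using hX
  -- (7) the division twists `(1+x)^{2^m}`, `σ((1+x)^{2^m})` per modulus
  obtain ⟨σ, hσσ, hσv', hnorm⟩ :=
    EllipticUnitsLocal.Discharged.exists_conj_divisionData (K := K) hK2 Nat.prime_two hv2 hvbar2 hne
  have hσv : ∀ y ∈ v.asIdeal, σ y ∈ vbar.asIdeal := conj_mem_of_mem σ hσσ hσv'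
  have hT : ∀ m : ℕ, ∃ α₁ α₂ : 𝓞 K, α₁ ≠ 0 ∧ α₂ ≠ 0 ∧ α₁ - 1 ∈ 𝔤 * vbar.asIdeal ^ (m + 1) ∧ α₂ - 1 ∈ 𝔤 * vbar.asIdeal ^ (m + 1) ∧
      IsCoprime (Ideal.span {α₁}) (𝔤 * vbar.asIdeal ^ (m + 1) * v.asIdeal) ∧
      IsCoprime (Ideal.span {α₂}) (𝔤 * vbar.asIdeal ^ (m + 1) * v.asIdeal) ∧
      α₁ - 1 ∈ v.asIdeal ^ ((m + 1) + 1) ∧ α₁ - 1 ∉ v.asIdeal ^ ((m + 1) + 2) ∧ α₂ - 1 ∈ v.asIdeal ^ ((m + 1) + 1) ∧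
      (∀ k : ℕ, 0 < k → ((α₂ : K) : v.adicCompletion K) ^ k ≠ ((α₁ : K) : v.adicCompletion K) ^ k) ∧
      2 ≤ Ideal.absNorm (Ideal.span {α₁}) ∧ 4 ∣ Ideal.absNorm (Ideal.span {α₁}) - 1 ∧
      Ideal.absNorm (Ideal.span {α₂}) = Ideal.absNorm (Ideal.span {α₁}) := fun m ↦
    exists_divisionTwists_twoVariable hv hvbar hw e₂ σ hσσ (h𝔤σ σ) hne hσv' hσv hnorm m
  choose α₁ α₂ hα₁0 hα₂0 hα₁𝔣 hα₂𝔣 hα₁c hα₂c hs₁ hs₁' hs₂ hne12 hN1 h4 hN12 using hT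
  -- the twists `(αᵢ(m))` as members of the family (prime to `𝔤v̄v`: `𝔤v̄v ∣ 𝔤v̄^{m+1}v`)
  have hdv : ∀ m : ℕ, 𝔤 * vbar.asIdeal * v.asIdeal ∣ 𝔤 * vbar.asIdeal ^ (m + 1) * v.asIdeal := fun m ↦
    mul_dvd_mul (mul_dvd_mul_left 𝔤 (dvd_pow_self _ (Nat.succ_ne_zero m))) dvd_rfl
  haveI hN : ∀ m n, ((rayAdicTower (𝔪 := 𝔤 * vbar.asIdeal ^ (m + 1)) (h𝔣0 m) v).U n).Normal :=
    fun m n ↦ rayAdicTower_U_normal (h𝔣0 m) v n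
  haveI hNabs : ∀ m n, ((absRayAdicTower (𝔪' := 𝔤 * vbar.asIdeal ^ (m + 1)) (h𝔣0 m) v).U n).Normal :=
    fun m n ↦ absRayAdicTower_U_normal (h𝔣0 m) v n
  -- (8) assemble
  refine ⟨h𝔣0, h𝔣1, hvm, hwm, modulus_anti, hq, h2, u, fun m ↦ α₀ ^ f m, fun m ↦ pow_ne_zero _ (ne_zero_of_asIdeal_eq_span hv0),
    hf𝔪, fun m w hw' ↦ pow_not_mem_of_ne hv0 w hw' (f m), f, hαπ, E, hfd, hgal, hE, hdegE, hEE, σ₀, hσ₀, ε, hε, θ, hθc, hθ1, hθζ,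
    fun m ↦ unitBallToUnrCoeff (hE m), fun m ↦ unitBallToUnrCoeff_comp_algebraMap (hE m),
    fun m ↦ algebraMap_comp_unitBallToUnrCoeff (hE m), hjj, e₂, hΘe, ψ, hψ, g, hg, x, hx, hN, hNabs, ?_⟩
  exact exists_twoVariable_groupDistribution_ellipticUnitsGlobal_of_principal h24ii h24iii h25 hK ι
    (fun m ↦ 𝔤 * vbar.asIdeal ^ (m + 1)) modulus_succ modulus_anti (fun m ↦ (dvd_pow_self _ (Nat.succ_ne_zero m)).mul_left 𝔤)
    h𝔣0 h𝔣1 hvm hwm hq h2 u hσ₀ hε θ hθ1 e₂ hΘe (fun m ↦ α₀ ^ f m) (fun m ↦ pow_ne_zero _ (ne_zero_of_asIdeal_eq_span hv0)) hf𝔪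
    (fun m w hw' ↦ pow_not_mem_of_ne hv0 w hw' (f m)) f hαπ E hE hdegE hEE (fun m ↦ unitBallToUnrCoeff (hE m))
    (fun m ↦ unitBallToUnrCoeff_comp_algebraMap (hE m)) (fun m ↦ algebraMap_comp_unitBallToUnrCoeff (hE m)) hjj ψ hψ
    (fun c : {c : Ideal (𝓞 K) // c ≠ ⊥ ∧ IsCoprime c (𝔤 * vbar.asIdeal * v.asIdeal)} ↦ c.1) (fun c ↦ c.2.1)
    (fun c m ↦ isCoprime_modulus_mul c.2.2 m) g hg x hx (fun m ↦ m + 1) (fun m ↦ Nat.succ_pos m)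
    (fun m ↦ ⟨Ideal.span {α₁ m}, mt Ideal.span_singleton_eq_bot.mp (hα₁0 m), (hα₁c m).of_isCoprime_of_dvd_right (hdv m)⟩)
    (fun m ↦ ⟨Ideal.span {α₂ m}, mt Ideal.span_singleton_eq_bot.mp (hα₂0 m), (hα₂c m).of_isCoprime_of_dvd_right (hdv m)⟩)
    α₁ α₂ (fun _ ↦ rfl) (fun _ ↦ rfl) hα₁𝔣 hα₂𝔣 hs₁ hs₁' hs₂ hne12 hN1 h4 hN12
    ⟨Ideal.span {α₁ 0}, mt Ideal.span_singleton_eq_bot.mp (hα₁0 0), (hα₁c 0).of_isCoprime_of_dvd_right (hdv 0)⟩ (hN1 0)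

end Discharged

end Summit.BirchSwinnertonDyer.BirchSwinnertonDyer.Theorems.PrintCf2.EllipticUnitsTwoVariable

end
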